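import Summits.ResolutionOfSingularities.ResolutionOfSingularities.Theorems.MarkedTransferCampaignW46MohWindowShadeTerminationStatement
import Summits.ResolutionOfSingularities.ResolutionOfSingularities.Theorems.MarkedTransferCampaignW46MohWindowShadeTermination
import Summits.ResolutionOfSingularities.ResolutionOfSingularities.Theorems.MarkedTransferCampaignW46MohWindowShadeCycle
import HarnessLib

/-!
# [OURS · L1 W4.6] Rung (iii) "Moh window", SURFACES — the termination statement CLOSED BY NAME, with its
  non-vacuity witnesses (proofs only; no definitions)

Cell `res-hironaka`, rung L, slot W4.6, seat `res-L1-s46-pv-6` (gen 3).  `--kind proof --supports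
stmt-ResolutionOfSingularities-16155 --as helper`.

* `campaignW46MohWindowShadeSurfaceTerminates_holds` — the OURS predicate
  `CampaignW46MohWindowShadeSurfaceTerminates p K σ` of `…TerminationStatement.lean` holds for every prime `p`,
  every field `K` of characteristic `p` (decidable equality) and every finite two-letter index type: it is the
  seat's `MohWindowShadeTermination.exists_formal_curve_of_walk`, whose engine is the run formula
  (`…RunFormula`), the adapted-state lemmas (`…Adapted`), gen 2's terminal case and exit, gen 0's no-increase law.
* NON-VACUITY of the antecedent: `antecedent_inhabited` — for every `p` and `K` the seat's in-window TWO-CYCLE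
  (`MohWindowShadeCycle`: `F_{±1} = u^p y ± y^{p+1} + u^p y^{p+1}`, `r = (0,1)`, steps at the points `∓1` of
  the chart `y_1`) is an INFINITE walk satisfying every hypothesis of the predicate in the frame `j = 1`,
  `i = 0`; so the statement is not true for want of walks (and, by `_holds`, that walk meets the formal
  `p`-fold-curve case — indeed `F_{±1} = y·(u ∓ y + uy)^p`).
* NON-TRIVIALITY of the conclusion: `not_formalCurveCase_of_small_monomial` — a residual polynomial with a
  monomial `y^d`, all `d_l < p`, of degree `< m` is NOT in the formal `p`-fold-curve case to order `m` (every
  monomial of `h^p·w` with `h(0) = 0` has some exponent `≥ p`); e.g. the in-window terminal state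
  `(y_0^2 y_1^2, (2,2))` for `p = 3` (`not_formalCurveCase_example`).
OURS; NOT a statement of the manuscript [claim: Hironaka2017, status: under-review], nothing of which is used.
AI review is weaker than expert review.
-/

noncomputable section

set_option linter.dupNamespace false -- mandated namespace of this single-conjunct summit

open MvPolynomial Finset

namespace Summit.ResolutionOfSingularities.ResolutionOfSingularities.Theorems

open Literature.AlgebraicGeometry.Resolution
open Literature.AlgebraicGeometry.Resolution.PointBlowup
open Literature.AlgebraicGeometry.Resolution.Hauser2010
open Literature.Barriers.ResolutionOfSingularities (ordZero_le_of_coeff_ne_zero le_ordZero_of_forall)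

/-- **[OURS · L1 W4.6] Rung (iii), surfaces, termination half — CLOSED BY NAME.**  For every prime `p`, every
field `K` of characteristic `p` and every finite index type, `CampaignW46MohWindowShadeSurfaceTerminates p K σ`
holds: every infinite in-window walk of equimultiple point blow-ups of `x^p + F(y_j, y_i)` presented in the
Hauser–Wagner frame meets the formal `p`-fold-curve case.  NOT a statement of the manuscript. [folklore] -/
theorem campaignW46MohWindowShadeSurfaceTerminates_holds (p : ℕ) [Fact p.Prime] (K : Type*) [Field K]
    [DecidableEq K] [CharP K p] (σ : Type*) [Fintype σ] [DecidableEq σ] :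
    CampaignW46MohWindowShadeSurfaceTerminates p K σ := by
  intro j i hij htwo s c b hb hHW hstep hclean hr heq hwin
  obtain ⟨n, hn⟩ := CampaignW46.MohWindowShadeTermination.exists_formal_curve_of_walk p hij htwo s c b hb hHW
    hstep hclean hr heq hwin
  exact ⟨n, fun m => hn m⟩

/-- **[OURS · L1 W4.6] Small monomials exclude the formal `p`-fold-curve case (all dimensions).**  If the
residual polynomial `F` has a monomial `y^d` with every `d_l < p` and `|d| < m`, then `F` is not
`h^p·w + O(deg ≥ m)` for any `h` with `h(0) = 0`: every monomial of `h^p` is a non-constant `p`-th power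
monomial, so every monomial of `h^p·w` has some exponent `≥ p` and `y^d` survives in `F − h^p·w`.  In
particular in-window TERMINAL states `y^r·(unit)` with all `r_l < p` (gen 2's terminal case without proper
centre) are never in the formal curve case beyond order `|r|`.  NOT a statement of the manuscript. [folklore] -/
theorem not_formalCurveCase_of_small_monomial (p : ℕ) [hp : Fact p.Prime] {K : Type*} [Field K] [CharP K p]
    {σ : Type*} {F : MvPolynomial σ K} {d : σ →₀ ℕ} (hd : coeff d F ≠ 0) (hsmall : ∀ l, d l < p) {m : ℕ}
    (hm : d.degree < m) : ¬ CampaignW46MohWindowShadeFormalCurveCase p m F := by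
  classical
  rintro ⟨h, w, hh0, -, hord⟩
  have hzero : coeff d (h ^ p * w) = 0 := by
    rw [coeff_mul]
    refine Finset.sum_eq_zero fun x hx => ?_
    rw [Finset.mem_antidiagonal] at hx
    by_cases ha : coeff x.1 (h ^ p) = 0
    · rw [ha, zero_mul]
    · exfalso
      have hPPS := CampaignW46.MohWindowShadeCleaning.forall_support_pow_char p h x.1
        (MvPolynomial.mem_support_iff.mpr ha)
      rw [isPthPowerExponent_iff] at hPPS
      by_cases hx0 : x.1 = 0
      · apply ha
        rw [hx0, ← constantCoeff_eq, map_pow, constantCoeff_eq, hh0, zero_pow hp.out.ne_zero]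
      · obtain ⟨l, hl⟩ : ∃ l, x.1 l ≠ 0 := by
          by_contra hall
          push Not at hall
          exact hx0 (Finsupp.ext hall)
        have h1 : p ≤ x.1 l := Nat.le_of_dvd (Nat.pos_of_ne_zero hl) (hPPS l)
        have h2 : x.1 l ≤ d l := by
          have := DFunLike.congr_fun hx l
          rw [Finsupp.add_apply] at this
          omega
        exact absurd (hsmall l) (by omega)
  have hcoeff : coeff d (F - h ^ p * w) ≠ 0 := by
    rw [coeff_sub, hzero, sub_zero]; exact hd
  have h1 := ordZero_le_of_coeff_ne_zero _ d hcoeff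
  have h2 : ((m : ℕ) : ℕ∞) ≤ d.degree := le_trans hord h1
  have h3 : m ≤ d.degree := by exact_mod_cast h2
  omega

/-- **[OURS · L1 W4.6] Example: an in-window terminal state outside the formal curve case.**  For `p = 3` the
cleaned state `F = y_0^2 y_1^2` (`r = (2,2)`, order `4 ∈ [3, 6)`, `y^r ∣ F`) is not in the formal `3`-fold-curve
case to order `5`: the conclusion of `CampaignW46MohWindowShadeSurfaceTerminates` is a genuine restriction on
walks.  NOT a statement of the manuscript. [folklore] -/
theorem not_formalCurveCase_example (K : Type*) [Field K] [CharP K 3] :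
    ¬ CampaignW46MohWindowShadeFormalCurveCase 3 5
      (monomial (Finsupp.single (0 : Fin 2) 2 + Finsupp.single 1 2) (1 : K)) := by
  haveI : Fact (Nat.Prime 3) := ⟨Nat.prime_three⟩
  refine not_formalCurveCase_of_small_monomial 3 (d := Finsupp.single (0 : Fin 2) 2 + Finsupp.single 1 2)
    (by rw [coeff_monomial, if_pos rfl]; exact one_ne_zero) (fun l => ?_) (by simp)
  fin_cases l <;> simp

/-- **[OURS · L1 W4.6] The antecedent of `CampaignW46MohWindowShadeSurfaceTerminates` is INHABITED by an
infinite walk, for every prime `p` and every field of characteristic `p`** (kernel non-vacuity witness): the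
seat's in-window two-cycle `F_{ε} = u^p y + ε y^{p+1} + u^p y^{p+1}`, `ε = (−1)^n`, `r = (0, 1)`, blown up at
the point `−ε` of the `u`-axis in the chart `y` (`MohWindowShadeCycle.step_cyc`), is a walk in the
Hauser–Wagner frame `j = 1`, `i = 0` (the chart `y_0` is never used), cleaned, `y^r ∣ F`, every step
equimultiple, every state of order `p + 1` inside the window.  NOT a statement of the manuscript. [folklore] -/
theorem antecedent_inhabited (p : ℕ) [hp : Fact p.Prime] (K : Type*) [Field K] [DecidableEq K] [CharP K p] :
    ∃ (s : ℕ → State (Fin 2) K) (c : ℕ → Fin 2) (b : ℕ → Fin 2 → K),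
      (0 : Fin 2) ≠ 1 ∧ (∀ l : Fin 2, l = 1 ∨ l = 0) ∧
      (∀ n, b n (c n) = 0) ∧ (∀ n, c n = 0 → ∀ l, b n l = 0) ∧
      (∀ n, s (n + 1) = step p (c n) (b n) (s n)) ∧
      deletePthPowers p (s 0).F = (s 0).F ∧ (∀ d ∈ (s 0).F.support, (s 0).r ≤ d) ∧
      (∀ n, IsEquimultiplePoint p (c n) (b n) (s n)) ∧
      (∀ n, (p : ℕ∞) ≤ ordZero (s n).F ∧ ordZero (s n).F < (2 * p : ℕ)) := by
  have hp1 : 1 < p := hp.out.one_lt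
  -- the sign `ε n = (−1)^n` and the point `−ε n` (as in `MohWindowShadeCycle.exists_infinite_walk_in_window`)
  let ε : ℕ → K := fun n => (-1) ^ n
  have hε : ∀ n, ε n ≠ 0 := fun n => pow_ne_zero _ (neg_ne_zero.mpr one_ne_zero)
  have hεpow : ∀ n, (ε n) ^ p = ε n := by
    intro n
    show ((-1 : K) ^ n) ^ p = (-1) ^ n
    rw [← pow_mul, mul_comm, pow_mul, neg_one_pow_char K p]
  have hεp : ∀ n, (-(ε n)) ^ p = -(ε n) := by
    intro n
    rw [neg_pow, hεpow, neg_one_pow_char K p, neg_one_mul]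
  have hεs : ∀ n, ε (n + 1) = -(ε n) := fun n => by
    show (-1 : K) ^ (n + 1) = -((-1) ^ n); rw [pow_succ]; ring
  refine ⟨fun n => State.mk (CampaignW46.MohWindowShadeCycle.cycF K p (ε n)) CampaignW46.MohWindowShadeCycle.cycMult,
    fun _ => 1, fun n => ![-(ε n), 0], by decide, fun l => by fin_cases l <;> simp, fun _ => by simp,
    fun n h => absurd (show (1 : Fin 2) = 0 from h) (by decide), fun n => ?_, CampaignW46.MohWindowShadeCycle.deletePthPowers_cycF K p _,
    CampaignW46.MohWindowShadeCycle.cycMult_le_of_mem_support K p (hε 0),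
    fun n => CampaignW46.MohWindowShadeCycle.isEquimultiplePoint_cyc K p (hε n) (hεp n), fun n => ?_⟩
  · show State.mk (CampaignW46.MohWindowShadeCycle.cycF K p (ε (n + 1))) CampaignW46.MohWindowShadeCycle.cycMult
        = step p 1 ![-(ε n), 0]
          (State.mk (CampaignW46.MohWindowShadeCycle.cycF K p (ε n)) CampaignW46.MohWindowShadeCycle.cycMult)
    rw [CampaignW46.MohWindowShadeCycle.step_cyc K p (hε n) (hεp n), hεs n]
  · show ((p : ℕ) : ℕ∞) ≤ ordZero (CampaignW46.MohWindowShadeCycle.cycF K p (ε n)) ∧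
        ordZero (CampaignW46.MohWindowShadeCycle.cycF K p (ε n)) < (2 * p : ℕ)
    rw [CampaignW46.MohWindowShadeCycle.ordZero_cycF K p (hε n)]
    exact ⟨by exact_mod_cast (Nat.le_succ p), by exact_mod_cast (by omega : p + 1 < 2 * p)⟩

/-- **[OURS · L1 W4.6] … and on that walk the predicate's conclusion is therefore in force**: the two-cycle
meets the formal `p`-fold-curve case (indeed `F_{±1} = y·(u ∓ y + uy)^p` on the nose).  NOT a statement of
the manuscript. [folklore] -/
theorem cycle_meets_formalCurveCase (p : ℕ) [Fact p.Prime] (K : Type*) [Field K] [DecidableEq K]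
    [CharP K p] :
    ∃ (s : ℕ → State (Fin 2) K) (c : ℕ → Fin 2) (b : ℕ → Fin 2 → K),
      (∀ n, s (n + 1) = step p (c n) (b n) (s n)) ∧
      ∃ n, ∀ m : ℕ, CampaignW46MohWindowShadeFormalCurveCase p m (s n).F := by
  obtain ⟨s, c, b, h01, htwo, hb, hHW, hstep, hclean, hr, heq, hwin⟩ := antecedent_inhabited p K
  exact ⟨s, c, b, hstep, campaignW46MohWindowShadeSurfaceTerminates_holds p K (Fin 2) 1 0 h01 htwo s c b hb
    hHW hstep hclean hr heq hwin⟩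

end Summit.ResolutionOfSingularities.ResolutionOfSingularities.Theorems
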